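import Mathlib
import HarnessLib
import Literature.Analysis.FluidPDE.RieszKernelBounds
import Literature.Analysis.FluidPDE.CalderonSplittingLp
import Literature.Analysis.FluidPDE.NewtonKernel
import Literature.Analysis.FluidPDE.TaoEnergyLocalisationProofs
import Summits.NavierStokesRegularity.NavierStokesRegularity.Theorems.QuarterLogPincerQuietCollarShellGeometry

/-!
# Route `QuarterLogPincer`, crux `TypeIQuantSubcubicExp` (stmt-NavierStokesRegularity-24077), line `quiet_collar` — towards QP2
# `stub_cutPair`, module M2: THE LOG-SHARP SUP BOUND OF THE SHELL POTENTIAL `∇Δ⁻¹(∇χ·v₀)`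

The data error of the cut pair `(V = χv(·−1), u₀ = P[χv(−1)] + far surgery)` is `w = ∇π[χv₀] = ∇Δ⁻¹div(χv₀)`,
`div(χv₀) = ∇χ·v₀` living on the quiet collar `{r ≤ |t| ≤ r + L}` with size `≤ D ≍ ηq/L`.  The crude sup bound of the tree
(`CalderonSplittingLp.abs_fderiv_divPotential_le_of_support`, linear in the support radius) gives `ηq·r/L`; the truth, and what
the re-typed QP2 needs (typed audit, pub-ns-dss bus 2026-08-29T01:10Z: only a LOG of the radius is absorbable by QP1⁺
`quietCollar_log`), is `|w| ≲ D·L·(1 + log(r/L)) ≍ ηq·(1 + log(r/L))`: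

* `exists_abs_fderiv_newtonPotential_shell_le` — for a `C¹_c` scalar source `σ`, `|σ| ≤ D`, vanishing off the shell:
  `|∂ᵥ(σ ⋆ Γ)(x)| ≤ C·D·L·(1 + log(r/L))·‖v‖` (kernel-gradient representation `integral_newtonKernel_smul_fderiv_eq`,
  `‖DΓ(z)‖ ≤ (4π|z|²)⁻¹`, and the dyadic layer bound `exists_lintegral_shell_powKer_two_le` of `…QuietCollarShellGeometry`);
* `exists_norm_gradient_divPotential_shell_le` — hence `‖∇π[G](x)‖ ≤ C·D·L·(1 + log(r/L))` for every test field `G` whose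
  divergence is bounded by `D` and vanishes off the shell;
* `exists_norm_gradient_divPotential_cutRef_le` — THE CONSUMABLE FORM: for a smooth divergence-free `a`, `η`-quiet on the collar,
  and `χ = radialCutoff r (r+L)`: `‖∇π[χa](x)‖ ≤ C·η·(1 + log(r/L))` everywhere (`div(χa) = ∇χ·a`, `|∇χ| ≤ C₁/L` from Tao's
  (58) through the bridge `radialCutoff_eq_taoCutoff`), i.e. the Leray projection `P[χa]` is `Cη(1+log(r/L))`-close to `χa`
  in sup norm — with the log-weighted collar level `η = ηq/(1 + log r)` of QP1⁺ this is `≤ C·ηq`, UNIFORMLY IN `r`.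

r-INDEPENDENT groundwork for QP2.  HONEST FRAME: potential theory of a shell source; nothing here bears on 24077, W7 or
Navier–Stokes regularity (OPEN).  Helper of the pub-ns-dss typer (g36), `--supports 24077`.
-/

noncomputable section

set_option linter.dupNamespace false

namespace Summit.NavierStokesRegularity.NavierStokesRegularity.Cruxes.TypeIQuantSubcubicExp.QuietCollar

open MeasureTheory Set Function Filter Real Metric ContinuousLinearMap
open scoped ENNReal NNReal Topology Convolution
open Literature.Analysis.FluidPDE.RieszKernel (powKer powKer_apply)
open Literature.Analysis Literature.Analysis.FluidPDE Literature.Analysis.FluidPDE.CalderonSplittingLp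

/-- **LOG-SHARP SUP BOUND OF A NEWTONIAN GRADIENT WITH A SHELL SOURCE**: there is an absolute `C > 0` such that for every
`C¹` compactly supported source `σ` with `|σ| ≤ D`, vanishing off the shell `{r ≤ |t| ≤ r + L}` (`0 < L ≤ r`), the gradient
of its Newtonian potential obeys `|∂ᵥ(σ ⋆ Γ)(x)| ≤ C·D·L·(1 + log(r/L))·‖v‖` at EVERY `x` (kernel-gradient representation
`∂ᵥ(σ ⋆ Γ)(x) = ∫ ∂ᵥΓ(x − t)σ(t)dt`, `‖DΓ(z)‖ ≤ (4π|z|²)⁻¹`, and the dyadic layer bound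
`exists_lintegral_shell_powKer_two_le`).  The point: the bound is `L·log(r/L)`, not the crude `L^{1/3}r^{2/3}` of a source
of the same size and total mass. [folklore] -/
theorem exists_abs_fderiv_newtonPotential_shell_le :
    ∃ C : ℝ, 0 < C ∧ ∀ (σ : EuclideanSpace ℝ (Fin 3) → ℝ) (r L D : ℝ), ContDiff ℝ 1 σ → HasCompactSupport σ →
      0 < L → L ≤ r → 0 ≤ D → (∀ t, |σ t| ≤ D) → (∀ t, σ t ≠ 0 → r ≤ ‖t‖ ∧ ‖t‖ ≤ r + L) →
      ∀ x v : EuclideanSpace ℝ (Fin 3),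
        |fderiv ℝ (σ ⋆[lsmul ℝ ℝ, volume] newtonKernel) x v| ≤ C * D * L * (1 + Real.log (r / L)) * ‖v‖ := by
  obtain ⟨C₀, hC₀, hshell⟩ := exists_lintegral_shell_powKer_two_le
  refine ⟨(4 * Real.pi)⁻¹ * C₀, by positivity, ?_⟩
  intro σ r L D hσ hσc hL hLr hD0 hD hsupp x v
  have hℓ : 0 ≤ Real.log (r / L) := Real.log_nonneg ((one_le_div hL).2 hLr)
  set A : Set (EuclideanSpace ℝ (Fin 3)) := {y | r ≤ ‖y‖ ∧ ‖y‖ ≤ r + L} with hA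
  have hAm : MeasurableSet A :=
    (measurableSet_le measurable_const continuous_norm.measurable).inter
      (measurableSet_le continuous_norm.measurable measurable_const)
  -- kernel-gradient representation
  have hrep : fderiv ℝ (σ ⋆[lsmul ℝ ℝ, volume] newtonKernel) x v = ∫ t, fderiv ℝ newtonKernel (x - t) v * σ t := by
    rw [fderiv_convolution_newtonKernel_apply hσ hσc x v, convolution_newtonKernel_apply']
    have h := integral_newtonKernel_smul_fderiv_eq (F := ℝ) hσ hσc x v
    simp only [smul_eq_mul] at h
    exact h
  -- pointwise majorant by the shell kernel
  set c : ℝ≥0∞ := ENNReal.ofReal (‖v‖ * D * (4 * Real.pi)⁻¹) with hc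
  have hpt : ∀ t, ENNReal.ofReal ‖fderiv ℝ newtonKernel (x - t) v * σ t‖ ≤
      A.indicator (fun t => c * powKer 2 (x - t)) t := by
    intro t
    by_cases hσt : σ t = 0
    · rw [hσt, mul_zero, norm_zero, ENNReal.ofReal_zero]; exact bot_le
    have hmem : t ∈ A := hsupp t hσt
    rw [indicator_of_mem hmem, hc, powKer_apply, Real.rpow_neg (norm_nonneg _), Real.rpow_two,
      ← ENNReal.ofReal_mul (by positivity)]
    refine ENNReal.ofReal_le_ofReal ?_
    rw [norm_mul, Real.norm_eq_abs]
    have hk : ‖fderiv ℝ newtonKernel (x - t) v‖ ≤ (4 * Real.pi * ‖x - t‖ ^ 2)⁻¹ * ‖v‖ :=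
      (le_opNorm _ _).trans (mul_le_mul_of_nonneg_right (norm_fderiv_newtonKernel_le _) (norm_nonneg _))
    calc ‖fderiv ℝ newtonKernel (x - t) v‖ * |σ t| ≤ (4 * Real.pi * ‖x - t‖ ^ 2)⁻¹ * ‖v‖ * D :=
          mul_le_mul hk (hD t) (abs_nonneg _) (by positivity)
      _ = ‖v‖ * D * (4 * Real.pi)⁻¹ * (‖x - t‖ ^ 2)⁻¹ := by rw [mul_inv]; ring
  have hlin : ∫⁻ t, ENNReal.ofReal ‖fderiv ℝ newtonKernel (x - t) v * σ t‖ ≤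
      c * ENNReal.ofReal (C₀ * L * (1 + Real.log (r / L))) := by
    calc ∫⁻ t, ENNReal.ofReal ‖fderiv ℝ newtonKernel (x - t) v * σ t‖
        ≤ ∫⁻ t, A.indicator (fun t => c * powKer 2 (x - t)) t := lintegral_mono hpt
      _ = c * ∫⁻ t in A, powKer 2 (x - t) := by
          rw [lintegral_indicator hAm, lintegral_const_mul' _ _ ENNReal.ofReal_ne_top]
      _ ≤ c * ENNReal.ofReal (C₀ * L * (1 + Real.log (r / L))) := mul_le_mul' le_rfl (hshell r L hL hLr x)
  rw [hrep, ← Real.norm_eq_abs]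
  refine (norm_integral_le_lintegral_norm _).trans ?_
  refine ENNReal.toReal_le_of_le_ofReal (by positivity) (hlin.trans (le_of_eq ?_))
  rw [hc, ← ENNReal.ofReal_mul (by positivity)]
  congr 1
  ring

/-- **LOG-SHARP SUP BOUND OF `∇π[G]` FOR A SHELL-SUPPORTED DIVERGENCE** (M2 of QP2): there is an absolute `C > 0` such that
for every test field `G ∈ C_c^∞(ℝ³;ℝ³)` whose divergence is bounded by `D` and vanishes off the shell `{r ≤ |t| ≤ r + L}`
(`0 < L ≤ r`) — e.g. `G = χ·v₀` with `v₀` divergence-free and `χ = radialCutoff r (r+L)`, `div G = ∇χ·v₀` — the gradient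
`w = ∇π[G] = ∇Δ⁻¹div G` (the data error of the cut pair, `u₀ − χv₀ = −w` up to the far surgery) satisfies
`‖∇π[G](x)‖ ≤ C·D·L·(1 + log(r/L))` at EVERY `x`. [folklore] -/
theorem exists_norm_gradient_divPotential_shell_le :
    ∃ C : ℝ, 0 < C ∧ ∀ (G : EuclideanSpace ℝ (Fin 3) → EuclideanSpace ℝ (Fin 3)) (r L D : ℝ),
      ContDiff ℝ (⊤ : ℕ∞) G → HasCompactSupport G → 0 < L → L ≤ r → 0 ≤ D →
      (∀ t, |VectorCalculus.divergence G t| ≤ D) →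
      (∀ t, VectorCalculus.divergence G t ≠ 0 → r ≤ ‖t‖ ∧ ‖t‖ ≤ r + L) →
      ∀ x : EuclideanSpace ℝ (Fin 3), ‖gradient (divPotential G) x‖ ≤ C * D * L * (1 + Real.log (r / L)) := by
  obtain ⟨C, hC, hb⟩ := exists_abs_fderiv_newtonPotential_shell_le
  refine ⟨3 * C, by positivity, ?_⟩
  intro G r L D hG hGc hL hLr hD0 hD hsupp x
  have hℓ : 0 ≤ Real.log (r / L) := Real.log_nonneg ((one_le_div hL).2 hLr)
  have hσ1 : ContDiff ℝ 1 (VectorCalculus.divergence G) := (contDiff_divergence_of_contDiff_top hG).of_le (by norm_cast)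
  have hσc : HasCompactSupport (VectorCalculus.divergence G) := hasCompactSupport_divergence hGc
  have hv : ∀ v, |fderiv ℝ (divPotential G) x v| ≤ C * D * L * (1 + Real.log (r / L)) * ‖v‖ :=
    fun v => hb _ r L D hσ1 hσc hL hLr hD0 hD hsupp x v
  have h0 : 0 ≤ C * D * L * (1 + Real.log (r / L)) := by positivity
  rw [norm_gradient_eq_norm_fderiv]
  refine (opNorm_le_bound _ h0 fun v => ?_).trans (by linarith)
  rw [Real.norm_eq_abs]; exact hv v

/-- **THE DATA ERROR OF THE LERAY-PROJECTED CUT REFERENCE, r-UNIFORMLY UP TO `log r`** (M2 of QP2 in consumable form): there is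
an absolute `C > 0` such that for every smooth divergence-free `a` that is `η`-QUIET ON THE COLLAR `{r ≤ |t| ≤ r + L}`
(`0 < L ≤ r`) and the cut reference `χ·a`, `χ = radialCutoff r (r+L)` (`= 1` on `B̄(r)`, `= 0` off `B(r+L)`, `|∇χ| ≤ C₁/L`),
the gradient part of its Helmholtz decomposition obeys `‖∇π[χ·a](x)‖ ≤ C·η·(1 + log(r/L))` at EVERY `x` — so the Leray
projection `P[χa] = χa − ∇π[χa]` (smooth, divergence-free: `isDivFree_classicalLerayProj`) is `C·η·(1+log(r/L))`-close to `χa`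
in sup norm (`div(χa) = ∇χ·a` is `≤ C₁η/L` and lives on the collar; `exists_norm_gradient_divPotential_shell_le`). [folklore] -/
theorem exists_norm_gradient_divPotential_cutRef_le :
    ∃ C : ℝ, 0 < C ∧ ∀ (a : EuclideanSpace ℝ (Fin 3) → EuclideanSpace ℝ (Fin 3)) (r L η : ℝ),
      ContDiff ℝ (⊤ : ℕ∞) a → VectorCalculus.IsDivFree a → 0 < L → L ≤ r → 0 ≤ η →
      (∀ t, r ≤ ‖t‖ → ‖t‖ ≤ r + L → ‖a t‖ ≤ η) →
      ∀ x : EuclideanSpace ℝ (Fin 3),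
        ‖gradient (divPotential fun y => radialCutoff r (r + L) y • a y) x‖ ≤ C * η * (1 + Real.log (r / L)) := by
  obtain ⟨C, hC, hM2⟩ := exists_norm_gradient_divPotential_shell_le
  obtain ⟨C₁, hC₁, hC₁b⟩ := exists_norm_fderiv_taoCutoff_le (E := EuclideanSpace ℝ (Fin 3))
  refine ⟨C * C₁, by positivity, ?_⟩
  intro a r L η ha hdiv hL hLr hη hquiet x
  have hr : 0 < r := lt_of_lt_of_le hL hLr
  have hR : 0 < r + L := by linarith
  have hrR : r < r + L := by linarith
  have hℓ : 0 ≤ Real.log (r / L) := Real.log_nonneg ((one_le_div hL).2 hLr)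
  -- the cut-off: smooth, compactly supported, `‖∇χ‖ ≤ C₁/L`, locally constant off the collar
  have hχs : ContDiff ℝ (⊤ : ℕ∞) (radialCutoff r (r + L) : EuclideanSpace ℝ (Fin 3) → ℝ) := radialCutoff_contDiff r (r + L)
  have hχd : ∀ t, ‖fderiv ℝ (radialCutoff r (r + L) : EuclideanSpace ℝ (Fin 3) → ℝ) t‖ ≤ C₁ / L := by
    have hw : 0 < ((r + L) ^ 2 - r ^ 2) / (r + L) := div_pos (by nlinarith) hR
    have hfun : (radialCutoff r (r + L) : EuclideanSpace ℝ (Fin 3) → ℝ) = taoCutoff (r + L) (((r + L) ^ 2 - r ^ 2) / (r + L)) :=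
      funext fun z => radialCutoff_eq_taoCutoff hR.ne' z
    intro t
    rw [hfun]
    refine (hC₁b (r + L) _ hw hR t).trans (div_le_div_of_nonneg_left hC₁.le hL ?_)
    rw [le_div_iff₀ hR]
    nlinarith
  have hχoff : ∀ t : EuclideanSpace ℝ (Fin 3), ¬ (r ≤ ‖t‖ ∧ ‖t‖ ≤ r + L) →
      fderiv ℝ (radialCutoff r (r + L) : EuclideanSpace ℝ (Fin 3) → ℝ) t = 0 := by
    intro t ht
    rcases lt_or_ge ‖t‖ r with h1 | h1
    · rw [(radialCutoff_eventuallyEq_one hr.le hrR h1).fderiv_eq, fderiv_const_apply]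
    · have h2 : r + L < ‖t‖ := lt_of_not_ge fun h => ht ⟨h1, h⟩
      rw [(radialCutoff_eventuallyEq_zero hr.le hrR h2).fderiv_eq, fderiv_const_apply]
  -- the cut field: smooth, compactly supported, with divergence `∇χ·a`
  have hG : ContDiff ℝ (⊤ : ℕ∞) (fun y => radialCutoff r (r + L) y • a y) := hχs.smul ha
  have hGc : HasCompactSupport (fun y => radialCutoff r (r + L) y • a y) :=
    (hasCompactSupport_radialCutoff hr.le hrR).smul_right
  have hdivG : ∀ t, VectorCalculus.divergence (fun y => radialCutoff r (r + L) y • a y) t =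
      fderiv ℝ (radialCutoff r (r + L) : EuclideanSpace ℝ (Fin 3) → ℝ) t (a t) := by
    intro t
    rw [divergence_smul_apply ((hχs.differentiable (by simp)) t) ((ha.differentiable (by simp)) t), hdiv t, mul_zero,
      zero_add, real_inner_comm, gradient, InnerProductSpace.toDual_symm_apply]
  have hD : ∀ t, |VectorCalculus.divergence (fun y => radialCutoff r (r + L) y • a y) t| ≤ C₁ / L * η := by
    intro t
    rw [hdivG]
    by_cases ht : r ≤ ‖t‖ ∧ ‖t‖ ≤ r + L
    · rw [← Real.norm_eq_abs]
      exact (le_opNorm _ _).trans (mul_le_mul (hχd t) (hquiet t ht.1 ht.2) (norm_nonneg _) (by positivity))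
    · rw [hχoff t ht, zero_apply, abs_zero]; positivity
  have hsupp : ∀ t, VectorCalculus.divergence (fun y => radialCutoff r (r + L) y • a y) t ≠ 0 → r ≤ ‖t‖ ∧ ‖t‖ ≤ r + L := by
    intro t ht
    by_contra hcon
    exact ht (by rw [hdivG, hχoff t hcon, zero_apply])
  refine (hM2 _ r L (C₁ / L * η) hG hGc hL hLr (by positivity) hD hsupp x).trans (le_of_eq ?_)
  field_simp

end Summit.NavierStokesRegularity.NavierStokesRegularity.Cruxes.TypeIQuantSubcubicExp.QuietCollar


end
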